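import Summits.QuantumFields.BalabanUV.Beta.CompositeOneShotJetData
import Summits.QuantumFields.BalabanUV.Beta.SymAveragingHessianCounts

/-!
# `BalabanUV.Beta.FP.TowerWardPinLocks` — row D1 ∕ (C1) OWNER «beta-an2», PART 119: PREDICTION-AN2-87a BY KERNEL — over the `hW𝒯 j` END skeleton's displayed scalar rows
# (`hr hcVH hcΛ hcB hcM₂ hLk`, road FP v10 ∕ skeleton Z) the two (W)_j locks of PART 116 (`Pn.cM m 0 = Pn.cΛ m`, `Pn.cΛ m · Pn.cE m = 2`) are EQUIVALENT to the second scalar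
# lock `κ₂ n = −1` (given the first), and force `Pn.cB m = −1`, `c(n)²·r(n)²·(Lc⁴)^m = 1`, and the border lock `2·cB = cE·cVH` — pure real algebra

HONEST DEPENDENCY (page 1, mandatory): continuum YM on T⁴ ⇐ BetaPertH ∧ nine spine estimates (0/9 proved); BetaPertH ⇐ (D1) ∧ (D4) ∧ CAP+tail;
G-an2-4 gates asym, D1 and NE2/3/4.  HONEST FRAMING (cell contract, verbatim): «discharging `BetaPertH` makes Bałaban's UV stability UNCONDITIONAL —
a real constructive-QFT result; it is NOT the continuum limit and NOT the Clay problem.»  ABSOLUTE RULE (cell charter, verbatim): «No internally-minted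
statement may enter as a cited fact. Every hypothesis is either kernel-proved in this package or a verbatim quotation of a PUBLISHED theorem with page
reference. The manuscript(s) under audit are NOT citable for their own disputed steps — they are the thing under adjudication; programme-internal
(2001/route/tribunal) claims are never citable.»

WHY (an2 gen 87, journal [AN2-G87-W-1] PREDICTION-AN2-87a; road FP g64 A-5 `xread-g64-ProbeK2Lock` 544bc04d (NOT-TO-FILE) — CREDITED: the road's `kappa2_forced` ∕ `wardLock_of_kappa2`
are the same algebra; this file puts it in the tree so the END re-cut (XREAD-T `hWT_rooted_ctr`) and PART 116's consumers cite one name instead of inlining four `linear_combination`s).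
The rows are v10's displayed scalar data at depth `m = n+2`: `hr : (−2·c n)·r n = cE`, `hcVH : 2·cVH = −(Lc⁴)^m·cE`, `hcΛ : 2·cΛ = (Lc⁴)^m·cE`, `hcB : c²·r·r·|box 4 Lc|^m = −cB`,
`hcM₂ : sn·cM₂·r·r = 1`, `hLk : c·cΛ = sn·cM₂·r·κ₂`.  By value at (2,3), n = 0 (TEL2's registered P-record, A-5): `κ₂ 0 = −1`, `cB = −1`, `c²r²·3⁸ = 1`, `cΛ·cE = 2` — inhabited.

WHAT: [folklore] real algebra; no `def`, no `def … : Prop`, nothing cited, 0 sorry.  Zero weight on any binder: the rows and locks are DISPLAYED HYPOTHESES of OUR designs; nothing of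
Bałaban's asserted, valued or discharged; 0 estimates; 0∕4 row-D1 binders; NOT (C1), NOT D1, NEVER «G-an2-4 closed», NOT BetaPertH, NOT continuum, NOT Clay.  No existing file touched.
-/

namespace Summit.QuantumFields.BalabanUV.Beta.FP.TowerWardPinLocks

open Literature.MathematicalPhysics.QuantumFieldTheory.Balaban1983to89.Beta.AffineAveraging (box)
open Summit.QuantumFields.BalabanUV.Beta.CompositeOneShotJetData (Pins)
open Summit.QuantumFields.BalabanUV.Beta.SymAveragingHessianCounts (card_box)

/-- [folklore] **`kappa2_of_wardLocks` — PREDICTION-AN2-87a, FORWARD**: the rows `hr hcVH hcΛ hcB hcM₂ hLk` + the member-0 pin `Pn.cM m 0 = Pn.cΛ m` + the mixed-parity lock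
`Pn.cM m 0 · Pn.cE m = 2` force `κ₂ n = −1`, `Pn.cB m = −1`, `c(n)²·r(n)²·(Lc⁴)^m = 1`, and the border lock `2·Pn.cB m = Pn.cE m · Pn.cVH m` (`m = n+2`). -/
theorem kappa2_of_wardLocks (Lc : ℕ) (Pn : Pins) (n : ℕ) (c sn r cM₂ κ₂ : ℕ → ℝ)
    (hr : (-2 * (c n)) * (r n) = Pn.cE (n + 1 + 1))
    (hcVH : 2 * Pn.cVH (n + 1 + 1) = -(((Lc : ℝ) ^ (3 + 1)) ^ (n + 1 + 1) * Pn.cE (n + 1 + 1)))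
    (hcΛ : 2 * Pn.cΛ (n + 1 + 1) = ((Lc : ℝ) ^ (3 + 1)) ^ (n + 1 + 1) * Pn.cE (n + 1 + 1))
    (hcB : (c n) ^ 2 * (r n) * (r n) * ((box (3 + 1) Lc).card : ℝ) ^ (n + 1 + 1) = -(Pn.cB (n + 1 + 1)))
    (hcM₂ : (sn n) * (cM₂ n) * (r n) * (r n) = 1)
    (hLk : (c n) * Pn.cΛ (n + 1 + 1) = (sn n) * (cM₂ n) * (r n) * (κ₂ n))
    (hcM0 : Pn.cM (n + 1 + 1) 0 = Pn.cΛ (n + 1 + 1))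
    (hME : Pn.cM (n + 1 + 1) 0 * Pn.cE (n + 1 + 1) = 2) :
    κ₂ n = -1 ∧ Pn.cB (n + 1 + 1) = -1 ∧ (c n) ^ 2 * (r n) ^ 2 * ((Lc : ℝ) ^ (3 + 1)) ^ (n + 1 + 1) = 1 ∧
      2 * Pn.cB (n + 1 + 1) = Pn.cE (n + 1 + 1) * Pn.cVH (n + 1 + 1) := by
  rw [card_box, Nat.cast_pow] at hcB
  set S : ℝ := ((Lc : ℝ) ^ (3 + 1)) ^ (n + 1 + 1) with hS
  rw [hcM0] at hME
  have h1 : S * Pn.cE (n + 1 + 1) ^ 2 = 4 := by linear_combination Pn.cE (n + 1 + 1) * hcΛ.symm + 2 * hME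
  have h2 : (c n) ^ 2 * (r n) ^ 2 * S = 1 := by
    linear_combination (1 / 4 : ℝ) * h1 - (S / 4) * (2 * (c n) * (r n) - Pn.cE (n + 1 + 1)) * hr
  have hκ : κ₂ n = (c n) * Pn.cΛ (n + 1 + 1) * (r n) := by linear_combination (-(κ₂ n)) * hcM₂ - (r n) * hLk
  refine ⟨?_, by linear_combination hcB - h2, h2, ?_⟩
  · rw [hκ]
    linear_combination ((c n) * (r n) / 2) * hcΛ + (-(c n) * (r n) * S / 2) * hr - h2
  · have : Pn.cVH (n + 1 + 1) = -(S * Pn.cE (n + 1 + 1)) / 2 := by linear_combination (1 / 2 : ℝ) * hcVH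
    rw [this, ← hr]; linear_combination (2 : ℝ) * hcB

/-- [folklore] **`wardLocks_of_kappa2` — CONVERSE**: the rows `hr hcVH hcΛ hcB hcM₂ hLk` + `κ₂ n = −1` give the mixed-parity lock `Pn.cΛ m · Pn.cE m = 2`, `c²r²(Lc⁴)^m = 1`,
`Pn.cB m = −1` and the border lock `2·cB = cE·cVH` — so at the END the (W)_j letters cost ONE pin row `Pn.cM m 0 = Pn.cΛ m` and ONE scalar lock `κ₂ = −1` (the twin of (K1′)'s `κ₁ = −1`). -/
theorem wardLocks_of_kappa2 (Lc : ℕ) (Pn : Pins) (n : ℕ) (c sn r cM₂ κ₂ : ℕ → ℝ)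
    (hr : (-2 * (c n)) * (r n) = Pn.cE (n + 1 + 1))
    (hcVH : 2 * Pn.cVH (n + 1 + 1) = -(((Lc : ℝ) ^ (3 + 1)) ^ (n + 1 + 1) * Pn.cE (n + 1 + 1)))
    (hcΛ : 2 * Pn.cΛ (n + 1 + 1) = ((Lc : ℝ) ^ (3 + 1)) ^ (n + 1 + 1) * Pn.cE (n + 1 + 1))
    (hcB : (c n) ^ 2 * (r n) * (r n) * ((box (3 + 1) Lc).card : ℝ) ^ (n + 1 + 1) = -(Pn.cB (n + 1 + 1)))
    (hcM₂ : (sn n) * (cM₂ n) * (r n) * (r n) = 1)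
    (hLk : (c n) * Pn.cΛ (n + 1 + 1) = (sn n) * (cM₂ n) * (r n) * (κ₂ n)) (hκ₂ : κ₂ n = -1) :
    Pn.cΛ (n + 1 + 1) * Pn.cE (n + 1 + 1) = 2 ∧ (c n) ^ 2 * (r n) ^ 2 * ((Lc : ℝ) ^ (3 + 1)) ^ (n + 1 + 1) = 1 ∧ Pn.cB (n + 1 + 1) = -1 ∧
      2 * Pn.cB (n + 1 + 1) = Pn.cE (n + 1 + 1) * Pn.cVH (n + 1 + 1) := by
  rw [card_box, Nat.cast_pow] at hcB
  set S : ℝ := ((Lc : ℝ) ^ (3 + 1)) ^ (n + 1 + 1) with hS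
  have hκ : (c n) * Pn.cΛ (n + 1 + 1) * (r n) = -1 := by linear_combination (r n) * hLk + (κ₂ n) * hcM₂ + hκ₂
  have h2 : (c n) ^ 2 * (r n) ^ 2 * S = 1 := by
    linear_combination -hκ + ((c n) * (r n) / 2) * hcΛ - ((c n) * (r n) * S / 2) * hr
  refine ⟨?_, h2, by linear_combination hcB - h2, ?_⟩
  · linear_combination (Pn.cE (n + 1 + 1) / 2) * hcΛ - (S / 2) * (Pn.cE (n + 1 + 1) - 2 * (c n) * (r n)) * hr + 2 * h2
  · have : Pn.cVH (n + 1 + 1) = -(S * Pn.cE (n + 1 + 1)) / 2 := by linear_combination (1 / 2 : ℝ) * hcVH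
    rw [this, ← hr]; linear_combination (2 : ℝ) * hcB

/-! ## §2 (v2 APPEND, gen 87 after `TEL2-RPRIME-INTERIM`) The UNIT of the depth-`m` N-system is fixed by two displayed letters alone

FINDING AN2-87-2 by name: the scalar row `hcΛ : 2·cΛ m = (Lc⁴)^m · cE m` and the mixed-parity Ward lock `hME : cM m 0 · cE m = 2` (with the member-0 pin `cM m 0 = cΛ m`)
already force `(Lc⁴)^m · (cE m)² = 4` — the free data `c sn r cM₂ κ₂` of the END do NOT enter.  At `(m, Lc) = (2, 3)`: `|cE 2| = 2/81` (TEL2's σ-record), whatever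
`sn 0`, `cM₂ 0` are; so no choice of the door-moment dictionary re-scales the depth-2 N-system, and the only unit levers are `hcΛ`'s power pattern and the anchor's
literal flow `cE m = (Lc^m)⁴` (PIN P-F6-2) carried by the transport row. -/

/-- [folklore] **`unit_of_mixedLock`** — the depth-`m` first-order unit is fixed by `hcΛ` and the mixed-parity lock alone: `(Lc⁴)^m · (Pn.cE m)² = 4` (`m = n+2`);
no free datum (`c sn r cM₂ κ₂`) enters. -/
theorem unit_of_mixedLock (Lc : ℕ) (Pn : Pins) (n : ℕ)
    (hcΛ : 2 * Pn.cΛ (n + 1 + 1) = ((Lc : ℝ) ^ (3 + 1)) ^ (n + 1 + 1) * Pn.cE (n + 1 + 1))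
    (hcM0 : Pn.cM (n + 1 + 1) 0 = Pn.cΛ (n + 1 + 1))
    (hME : Pn.cM (n + 1 + 1) 0 * Pn.cE (n + 1 + 1) = 2) :
    ((Lc : ℝ) ^ (3 + 1)) ^ (n + 1 + 1) * Pn.cE (n + 1 + 1) ^ 2 = 4 := by
  rw [hcM0] at hME
  linear_combination Pn.cE (n + 1 + 1) * hcΛ.symm + 2 * hME

/-- [folklore] **`unit_of_mixedLock_three_two`** — the instance TEL2 reads: at `Lc = 3`, depth `2` (`n = 0`), `(Pn.cE 2)² = 4 / 6561`, i.e. `|cE 2| = 2/81`. -/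
theorem unit_of_mixedLock_three_two (Pn : Pins)
    (hcΛ : 2 * Pn.cΛ (0 + 1 + 1) = (((3 : ℕ) : ℝ) ^ (3 + 1)) ^ (0 + 1 + 1) * Pn.cE (0 + 1 + 1))
    (hcM0 : Pn.cM (0 + 1 + 1) 0 = Pn.cΛ (0 + 1 + 1))
    (hME : Pn.cM (0 + 1 + 1) 0 * Pn.cE (0 + 1 + 1) = 2) :
    Pn.cE (0 + 1 + 1) ^ 2 = 4 / 6561 := by
  have h := unit_of_mixedLock 3 Pn 0 hcΛ hcM0 hME
  norm_num at h
  linear_combination h / 6561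

/-- [folklore] **`unit_ratio_of_rows`** — consecutive depths: under `hcΛ` and the mixed lock at depths `m` and `m+1`, `(Lc⁴) · (cE (m+1))² = (cE m)²` — the rows' unit
FLOW is `|cE (m+1)| = |cE m| / Lc²`, against the literal flow `cE (m+1) = Lc⁴ · cE m` of PIN P-F6-2 (`cE m = (Lc^m)⁴`) that the transport row carries. -/
theorem unit_ratio_of_rows (Lc : ℕ) (Pn : Pins) (n : ℕ)
    (hcΛ : 2 * Pn.cΛ (n + 1 + 1) = ((Lc : ℝ) ^ (3 + 1)) ^ (n + 1 + 1) * Pn.cE (n + 1 + 1))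
    (hcM0 : Pn.cM (n + 1 + 1) 0 = Pn.cΛ (n + 1 + 1))
    (hME : Pn.cM (n + 1 + 1) 0 * Pn.cE (n + 1 + 1) = 2)
    (hcΛ' : 2 * Pn.cΛ (n + 1 + 1 + 1) = ((Lc : ℝ) ^ (3 + 1)) ^ (n + 1 + 1 + 1) * Pn.cE (n + 1 + 1 + 1))
    (hcM0' : Pn.cM (n + 1 + 1 + 1) 0 = Pn.cΛ (n + 1 + 1 + 1))
    (hME' : Pn.cM (n + 1 + 1 + 1) 0 * Pn.cE (n + 1 + 1 + 1) = 2) :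
    (Lc : ℝ) ^ (3 + 1) * Pn.cE (n + 1 + 1 + 1) ^ 2 = Pn.cE (n + 1 + 1) ^ 2 := by
  have h1 := unit_of_mixedLock Lc Pn n hcΛ hcM0 hME
  have h2 := unit_of_mixedLock Lc Pn (n + 1) hcΛ' hcM0' hME'
  have hS : ((Lc : ℝ) ^ (3 + 1)) ^ (n + 1 + 1 + 1) = ((Lc : ℝ) ^ (3 + 1)) ^ (n + 1 + 1) * (Lc : ℝ) ^ (3 + 1) := pow_succ _ _
  rw [hS] at h2
  by_cases hL : ((Lc : ℝ) ^ (3 + 1)) ^ (n + 1 + 1) = 0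
  · rw [hL, zero_mul] at h1; norm_num at h1
  · exact mul_left_cancel₀ hL (by linear_combination h2 - h1)

/-! ## §3 (v3 APPEND, gen 87) The SCALED mixed lock: the group weight `w` IS `−κ₂`, and the literal flow picks `w = N¹²∕4` (g56's κ*)

The resolution of FINDING AN2-87-2 by name.  an2 g56 (`SymLamGroupScaling`, `CombMixedT2SiteLetterScaled`: the Λ∕multiplier∕mixed group scaled jointly by a weight `w`,
homogeneous lock `cΛ·Lc⁴ = 2·w`; ATK gate κ* = 3¹²∕4, `cΛ′ = Lc⁸∕2`) and the κ-generic root of record (`D1LiteralLagrangianRoot`, `(cΛ, w) = (2∕Lc⁴, Lc¹²∕4)`) carry the group at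
weight `w = Lc¹²∕4` at depth 1; the composite record's mixed slot at member 0 carries weight 1 (`M2Of_member_zero`).  With the mixed lock at a general weight,
`hMEw : cM m 0 · cE m = 2·w`, v10's rows give `κ₂ = −w`, `cB = −w`, `c²r²(Lc⁴)^m = w` and `(Lc⁴)^m·(cE m)² = 4·w`; so `κ₂ = −1` (v10's display, §1) IS the weight-1 choice, and the
literal flow `|cE m| = (Lc⁴)^m` holds iff `w = ((Lc⁴)^m)³∕4 = N¹²∕4` — κ* one storey up ((3²)¹²∕4 = 3²⁴∕4 = 7.06e10 at (m, Lc) = (2, 3): TEL2's number). -/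

/-- [folklore] **`kappa2_of_scaledLocks`** — v10's rows with the mixed lock at weight `w` (`cM m 0 · cE m = 2·w`, member-0 pin `cM m 0 = cΛ m`) force `κ₂ n = −w`,
`Pn.cB m = −w`, `c(n)²·r(n)²·(Lc⁴)^m = w` and the border lock `2·cB = cE·cVH` (`m = n+2`); `w = 1` is §1's `kappa2_of_wardLocks`. -/
theorem kappa2_of_scaledLocks (Lc : ℕ) (Pn : Pins) (n : ℕ) (c sn r cM₂ κ₂ : ℕ → ℝ) (w : ℝ)
    (hr : (-2 * (c n)) * (r n) = Pn.cE (n + 1 + 1))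
    (hcVH : 2 * Pn.cVH (n + 1 + 1) = -(((Lc : ℝ) ^ (3 + 1)) ^ (n + 1 + 1) * Pn.cE (n + 1 + 1)))
    (hcΛ : 2 * Pn.cΛ (n + 1 + 1) = ((Lc : ℝ) ^ (3 + 1)) ^ (n + 1 + 1) * Pn.cE (n + 1 + 1))
    (hcB : (c n) ^ 2 * (r n) * (r n) * ((box (3 + 1) Lc).card : ℝ) ^ (n + 1 + 1) = -(Pn.cB (n + 1 + 1)))
    (hcM₂ : (sn n) * (cM₂ n) * (r n) * (r n) = 1)
    (hLk : (c n) * Pn.cΛ (n + 1 + 1) = (sn n) * (cM₂ n) * (r n) * (κ₂ n))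
    (hcM0 : Pn.cM (n + 1 + 1) 0 = Pn.cΛ (n + 1 + 1))
    (hMEw : Pn.cM (n + 1 + 1) 0 * Pn.cE (n + 1 + 1) = 2 * w) :
    κ₂ n = -w ∧ Pn.cB (n + 1 + 1) = -w ∧ (c n) ^ 2 * (r n) ^ 2 * ((Lc : ℝ) ^ (3 + 1)) ^ (n + 1 + 1) = w ∧
      2 * Pn.cB (n + 1 + 1) = Pn.cE (n + 1 + 1) * Pn.cVH (n + 1 + 1) := by
  rw [card_box, Nat.cast_pow] at hcB
  set S : ℝ := ((Lc : ℝ) ^ (3 + 1)) ^ (n + 1 + 1) with hS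
  rw [hcM0] at hMEw
  have h1 : S * Pn.cE (n + 1 + 1) ^ 2 = 4 * w := by linear_combination Pn.cE (n + 1 + 1) * hcΛ.symm + 2 * hMEw
  have h2 : (c n) ^ 2 * (r n) ^ 2 * S = w := by
    linear_combination (1 / 4 : ℝ) * h1 - (S / 4) * (2 * (c n) * (r n) - Pn.cE (n + 1 + 1)) * hr
  have hκ : κ₂ n = (c n) * Pn.cΛ (n + 1 + 1) * (r n) := by linear_combination (-(κ₂ n)) * hcM₂ - (r n) * hLk
  refine ⟨?_, by linear_combination hcB - h2, h2, ?_⟩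
  · rw [hκ]
    linear_combination ((c n) * (r n) / 2) * hcΛ + (-(c n) * (r n) * S / 2) * hr - h2
  · have : Pn.cVH (n + 1 + 1) = -(S * Pn.cE (n + 1 + 1)) / 2 := by linear_combination (1 / 2 : ℝ) * hcVH
    rw [this, ← hr]; linear_combination (2 : ℝ) * hcB

/-- [folklore] **`unit_of_scaledMixedLock`** — `hcΛ` and the weight-`w` mixed lock give `(Lc⁴)^m · (cE m)² = 4·w`: the unit is the group weight's (v2's `unit_of_mixedLock` is `w = 1`). -/
theorem unit_of_scaledMixedLock (Lc : ℕ) (Pn : Pins) (n : ℕ) (w : ℝ)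
    (hcΛ : 2 * Pn.cΛ (n + 1 + 1) = ((Lc : ℝ) ^ (3 + 1)) ^ (n + 1 + 1) * Pn.cE (n + 1 + 1))
    (hcM0 : Pn.cM (n + 1 + 1) 0 = Pn.cΛ (n + 1 + 1))
    (hMEw : Pn.cM (n + 1 + 1) 0 * Pn.cE (n + 1 + 1) = 2 * w) :
    ((Lc : ℝ) ^ (3 + 1)) ^ (n + 1 + 1) * Pn.cE (n + 1 + 1) ^ 2 = 4 * w := by
  rw [hcM0] at hMEw
  linear_combination Pn.cE (n + 1 + 1) * hcΛ.symm + 2 * hMEw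

/-- [folklore] **`weight_of_literalFlow`** — under `hcΛ` and the weight-`w` mixed lock, the LITERAL flow `(cE m)² = ((Lc⁴)^m)²` (PIN P-F6-2: `cE m = ±(Lc^m)⁴`, the target
`D1Tel`'s `N_j⁸` transport) holds IFF-forward `w = ((Lc⁴)^m)³ ∕ 4` — i.e. `N¹²∕4` with `N = Lc^m`: g56's κ* = 3¹²∕4 at depth 1, 3²⁴∕4 at depth 2. -/
theorem weight_of_literalFlow (Lc : ℕ) (Pn : Pins) (n : ℕ) (w : ℝ)
    (hcΛ : 2 * Pn.cΛ (n + 1 + 1) = ((Lc : ℝ) ^ (3 + 1)) ^ (n + 1 + 1) * Pn.cE (n + 1 + 1))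
    (hcM0 : Pn.cM (n + 1 + 1) 0 = Pn.cΛ (n + 1 + 1))
    (hMEw : Pn.cM (n + 1 + 1) 0 * Pn.cE (n + 1 + 1) = 2 * w)
    (hflow : Pn.cE (n + 1 + 1) ^ 2 = (((Lc : ℝ) ^ (3 + 1)) ^ (n + 1 + 1)) ^ 2) :
    w = (((Lc : ℝ) ^ (3 + 1)) ^ (n + 1 + 1)) ^ 3 / 4 := by
  have h := unit_of_scaledMixedLock Lc Pn n w hcΛ hcM0 hMEw
  rw [hflow] at h
  linear_combination (-(1 : ℝ) / 4) * h

/-- [folklore] **`literalFlow_of_weight`** — conversely, at the weight `w = ((Lc⁴)^m)³∕4` the rows put the depth-`m` unit on the literal flow: `(cE m)² = ((Lc⁴)^m)²` (`Lc ≠ 0`). -/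
theorem literalFlow_of_weight (Lc : ℕ) (hLc : Lc ≠ 0) (Pn : Pins) (n : ℕ)
    (hcΛ : 2 * Pn.cΛ (n + 1 + 1) = ((Lc : ℝ) ^ (3 + 1)) ^ (n + 1 + 1) * Pn.cE (n + 1 + 1))
    (hcM0 : Pn.cM (n + 1 + 1) 0 = Pn.cΛ (n + 1 + 1))
    (hMEw : Pn.cM (n + 1 + 1) 0 * Pn.cE (n + 1 + 1) = 2 * ((((Lc : ℝ) ^ (3 + 1)) ^ (n + 1 + 1)) ^ 3 / 4)) :
    Pn.cE (n + 1 + 1) ^ 2 = (((Lc : ℝ) ^ (3 + 1)) ^ (n + 1 + 1)) ^ 2 := by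
  have h := unit_of_scaledMixedLock Lc Pn n _ hcΛ hcM0 hMEw
  have hS : ((Lc : ℝ) ^ (3 + 1)) ^ (n + 1 + 1) ≠ 0 := pow_ne_zero _ (pow_ne_zero _ (Nat.cast_ne_zero.mpr hLc))
  exact mul_left_cancel₀ hS (by linear_combination h)

/-- [folklore] **`weight_three_two`** — the instance TEL2 reads: at `Lc = 3`, depth 2, the literal-flow weight is `3²⁴∕4 = 70 607 384 120.25` (= (3¹²∕2)², an2 W-5's λ²). -/
theorem weight_three_two : ((((3 : ℕ) : ℝ) ^ (3 + 1)) ^ (0 + 1 + 1)) ^ 3 / 4 = 70607384120.25 := by norm_num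

end Summit.QuantumFields.BalabanUV.Beta.FP.TowerWardPinLocks
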